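import Summits.QuantumFields.BalabanUV.Beta.FP.OneShotKKTTorus

/-!
# `BalabanUV.Beta.FP.RootFixingGaugeForm` — road «FP» for binder row D1, row **GAMMA-10 (GAUGE FORM, MODEL)** of `LEAVES-FP.md`
# (owner d1-p3-g7, ruling R-FP-26 (c), memo `ROOTING-MIX.md` §3, journal 2026-08-21T01:24Z): CONJUGATION COVARIANCE OF BAŁABAN'S
# BORDERED MATRIX, THE SECOND-ORDER CHAIN RULE THROUGH A GAUGE MAP, AND THE GAUGE FORM `F^{root}(B) = F^{str}(B^{ax})` — AT MATRIX LEVEL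

HONEST DEPENDENCY (cell records, verbatim): «continuum YM on T⁴ ⇐ BetaPertH ∧ nine spine estimates (0/9 proved); BetaPertH ⇐ (D1) ∧ (D4) ∧
CAP+tail; G-an2-4 gates asym, D1 and NE2/3/4.»  HONEST FRAMING (cell contract, verbatim): «discharging `BetaPertH` makes Bałaban's UV stability
UNCONDITIONAL — a real constructive-QFT result; it is NOT the continuum limit and NOT the Clay problem.»  THIS MODULE is [folklore] block-matrix
algebra (Mathlib `Matrix.fromBlocks_multiply`, `Matrix.det_fromBlocks_zero₂₁`, `Matrix.det_mul`) and one-variable ∕ Fréchet calculus (Mathlib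
`HasFDerivAt.comp_hasDerivAt`, `HasDerivAt.clm_apply`) composed BY NAME with the tree's `Composition.kkt`, `CompositionSingular.flucCov ∕ minOp ∕
minOpL ∕ effForm ∕ kktInv_eq_fromBlocks` and `FP/OneShotKKTTorus` (row GAMMA-0 (a) ✓: `hasDerivAt_comp_curve`, `hasDerivAt_jet₁_comp_curve`,
`hasDerivAt_comp_line`, `hasDerivAt_oneShot_comp_curve_tadpole`).  NO estimate, NO lattice object, NO torus, NO gauge group is constructed (every
index type is an arbitrary `Fintype`, every «gauge transformation» an abstract letter), nothing of Bałaban's manuscripts, no definition, no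
`def … : Prop`, nothing cited, 0 sorry.  It discharges NOTHING of `hbook`∕`hasym`∕D1.  NOT D1, NOT BetaPertH, NOT continuum, NOT Clay.

ABSOLUTE RULE (cell charter, verbatim): «No internally-minted statement may enter as a cited fact. Every hypothesis is either kernel-proved in this
package or a verbatim quotation of a PUBLISHED theorem with page reference. The manuscript(s) under audit are NOT citable for their own disputed
steps — they are the thing under adjudication; programme-internal (2001/route/tribunal) claims are never citable.»

THE ROW (owner, `LEAVES-FP.md` GAMMA-10, verbatim core): «`det kkt(OHOᵀ, QOᵀ) = det kkt(H,Q)` (conjugation by `fromBlocks O 0 0 1`), second-order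
chain rule for `F∘ax`, with `htad` the pure pull-back `D²(F∘ax)(𝟙) = D²F(𝟙)[Dax·,Dax·]` — memo §3 at matrix level; simplifies GAMMA-4∕GAMMA-9 on the
road (no scalar averaging jets in tree-axial gauge).»  MEMO §3 (owner, paraphrased): root-fixing gauge covariance `H_cov(B^h) = Ad_h H_cov(B) Ad_h⁻¹`,
`Q^{root}_{B^h} = Q^{root}_B ∘ Ad_h⁻¹` ⟹ `det kkt` invariant; with the block-tree axialisation `B^{ax} := B^{h_B}` and `Q^{root} = Q^{str}` on tree-axial
backgrounds, `F^{root}(B) = F^{str}(B^{ax})` for `F := −½log|det kkt(H_cov(·), Q_·)|`, and `D²F^{root}(𝟙)[Ḃ,Ḃ] = D²F^{str}(𝟙)[P^{ax}Ḃ, P^{ax}Ḃ] +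
DF^{str}(𝟙)[(ax)″(Ḃ,Ḃ)]`, the last term killed by GAMMA-0c.
WHAT IS PROVED (model level, all [folklore]):
* §1 CONJUGATION COVARIANCE (any field `𝕜`; block-side letter `R` displayed next to the fine-side `O` — the row's `Q ↦ QOᵀ` is `R = 1`):
  `kkt_conj` (`kkt (OHOᵀ) (RQOᵀ) = [[O,0],[0,R]]·kkt H Q·[[O,0],[0,R]]ᵀ`), `det_kkt_conj` (`det = (det O·det R)²·det kkt(H,Q)`),
  **`det_kkt_conj_of_orthogonal`** ∕ **`det_kkt_conj_fine`** (the row's display), `isUnit_det_kkt_conj_iff`, **`log_abs_det_kkt_conj`** ∕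
  **`oneShot_conj`** (invertible `O, R`: the one shot is invariant UP TO THE ADDITIVE CONSTANT `−log|det O·det R|` — the `hinv` shape
  `Φ(ρv) = Φ(v) + c` of GAMMA-0c (ii) `FP/TadpoleAdInvariance`), and the LEGS **`blocks_conj_of_orthogonal`** (`Γ ↦ OΓOᵀ`, `𝓘 ↦ O𝓘Rᵀ`,
  `𝓘ᴸ ↦ R𝓘ᴸOᵀ`, `S ↦ RSRᵀ`).
* §2 SECOND-ORDER CHAIN RULE THROUGH A GAUGE MAP ALONG A LINE (normed spaces; `ax : E′ → E` with Fréchet jets `dax` near `x₀`, `d2ax` at `x₀`;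
  `F : E → G` with jets `dF` near `ax x₀`, `d2F` at `ax x₀`): **`hasDerivAt_comp_ax_line`** (`D²(F∘ax)(x₀)[v,v] = D²F[Dax v, Dax v] +
  DF(ax x₀)[D²ax(v,v)]`), **`…_of_tadpole_eq_zero`** ∕ **`…_of_fderiv_eq_zero`** (the PURE PULL-BACK; the latter hypothesis is GAMMA-0c's
  conclusion), and the ONE-SHOT INSTANCE **`hasDerivAt_oneShot_comp_ax_line`** ∕ **`…_of_tadpole_eq_zero`** (`KKTSecondVariation`'s six loops at
  the PULLED-BACK jets `DHf[Dax v]`, `DQf[Dax v]`, `D²Hf[Dax v, Dax v]`, `D²Qf[Dax v, Dax v]` + the `D²ax`-tadpole displayed).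
* §3 THE GAUGE FORM (background type `β`, gauge letters `𝒢`, action `act`, rotations `O h`, `R h`, predicates `RootFixing`, `Axial` — all
  VARIABLES, no def): **`det_kkt_eq_of_covariant`** ∕ **`oneShot_eq_of_covariant`**; **`oneShot_root_eq_str_ax`** (`F^{root}(B) = F^{str}(act (hB B) B)`
  from root-fixing covariance + an axialisation `hB` + the agreement `Axial B′ → Qroot B′ = Qstr B′`); **`legs_root_ax`**.
NOT HERE (honest): the tree-axial gauge instance (`Beta.AveragingContoursRooted.treeGaugeAt`∕`AxialGaugeAt`), the flux letters of `P^{ax}𝓘` (memo §3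
(γ)), transversality (δ) (`WardTransversal` BY NAME elsewhere), GAMMA-0c itself, any estimate; 0∕4 row-D1 binders touched.
Provenance: NE9 formalisation swarm leaf seat `b2b-balaban-t4-ne9-formalise-leaf-04` gen 38 on cross-cell kernel duty (road «FP» row GAMMA-10 «any
seat, statement-first», INTENT journal 2026-08-21T01:29Z), 2026-08-21.
-/

noncomputable section

namespace Summit.QuantumFields.BalabanUV.Beta.FP.RootFixingGaugeForm

open Matrix Filter Topology
open Literature.MathematicalPhysics.QuantumFieldTheory.Balaban1983to89.Beta.Composition (kkt)
open Literature.MathematicalPhysics.QuantumFieldTheory.Balaban1983to89.Beta.CompositionSingular (flucCov minOp minOpL effForm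
  kkt_eq_fromBlocks kktInv_eq_fromBlocks)
open Summit.QuantumFields.BalabanUV.Beta.FP.OneShotKKTTorus (hasDerivAt_comp_curve hasDerivAt_jet₁_comp_curve hasDerivAt_comp_line
  hasDerivAt_oneShot_comp_curve_tadpole)

/-! ## §1 Conjugation covariance of the bordered matrix -/

section Conjugation

variable {𝕜 : Type*} [Field 𝕜]
variable {ν μ : Type*} [Fintype ν] [Fintype μ] [DecidableEq ν] [DecidableEq μ]

omit [DecidableEq ν] [DecidableEq μ] in
/-- [folklore] **CONJUGATION OF THE BORDERED MATRIX**: rotating the fine variables by `O` and the block variables by `R` conjugates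
Bałaban's bordered matrix by the block-diagonal `fromBlocks O 0 0 R`:
`kkt (O H Oᵀ) (R Q Oᵀ) = [[O,0],[0,R]] · kkt H Q · [[O,0],[0,R]]ᵀ`.  (The row's «conjugation by `fromBlocks O 0 0 1`» is `R = 1`.) -/
theorem kkt_conj (H : Matrix ν ν 𝕜) (Q : Matrix μ ν 𝕜) (O : Matrix ν ν 𝕜) (R : Matrix μ μ 𝕜) :
    kkt (O * H * Oᵀ) (R * Q * Oᵀ) = fromBlocks O 0 0 R * kkt H Q * (fromBlocks O 0 0 R)ᵀ := by
  simp only [kkt_eq_fromBlocks, fromBlocks_transpose, fromBlocks_multiply, transpose_zero, transpose_mul, transpose_transpose,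
    Matrix.mul_zero, Matrix.zero_mul, add_zero, zero_add, Matrix.mul_assoc]

/-- [folklore] Determinant of the conjugated bordered matrix: `det kkt(OHOᵀ, RQOᵀ) = (det O · det R)² · det kkt(H, Q)`. -/
theorem det_kkt_conj (H : Matrix ν ν 𝕜) (Q : Matrix μ ν 𝕜) (O : Matrix ν ν 𝕜) (R : Matrix μ μ 𝕜) :
    (kkt (O * H * Oᵀ) (R * Q * Oᵀ)).det = (O.det * R.det) ^ 2 * (kkt H Q).det := by
  rw [kkt_conj, det_mul, det_mul, det_transpose, det_fromBlocks_zero₂₁]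
  ring

omit [Fintype μ] [DecidableEq μ] in
/-- [folklore] An orthogonal matrix has `det² = 1`. -/
theorem det_sq_eq_one_of_mul_transpose {O : Matrix ν ν 𝕜} (hO : O * Oᵀ = 1) : O.det ^ 2 = 1 := by
  have h := congrArg Matrix.det hO
  rwa [det_mul, det_transpose, det_one, ← sq] at h

/-- [folklore] **THE ROW'S FIRST DISPLAY**: for ORTHOGONAL rotations `O Oᵀ = 1`, `R Rᵀ = 1` the bordered determinant is INVARIANT,
`det kkt(OHOᵀ, RQOᵀ) = det kkt(H, Q)` (on the road: `O = Ad_h` on fine fields, `R = Ad_h` restricted to the block roots — `R = 1` for a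
ROOT-FIXING gauge transformation `h`). -/
theorem det_kkt_conj_of_orthogonal (H : Matrix ν ν 𝕜) (Q : Matrix μ ν 𝕜) {O : Matrix ν ν 𝕜} {R : Matrix μ μ 𝕜} (hO : O * Oᵀ = 1)
    (hR : R * Rᵀ = 1) : (kkt (O * H * Oᵀ) (R * Q * Oᵀ)).det = (kkt H Q).det := by
  rw [det_kkt_conj, mul_pow, det_sq_eq_one_of_mul_transpose hO, det_sq_eq_one_of_mul_transpose hR, one_mul, one_mul]

/-- [folklore] The row's display verbatim (`R = 1`, conjugation by `fromBlocks O 0 0 1`): `det kkt(OHOᵀ, QOᵀ) = det kkt(H, Q)` for `O Oᵀ = 1`. -/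
theorem det_kkt_conj_fine (H : Matrix ν ν 𝕜) (Q : Matrix μ ν 𝕜) {O : Matrix ν ν 𝕜} (hO : O * Oᵀ = 1) :
    (kkt (O * H * Oᵀ) (Q * Oᵀ)).det = (kkt H Q).det := by
  have h := det_kkt_conj_of_orthogonal H Q hO (R := (1 : Matrix μ μ 𝕜)) (by rw [transpose_one, Matrix.mul_one])
  rwa [Matrix.one_mul] at h

/-- [folklore] Non-degeneracy of the bordered matrix is transported by invertible rotations. -/
theorem isUnit_det_kkt_conj_iff (H : Matrix ν ν 𝕜) (Q : Matrix μ ν 𝕜) {O : Matrix ν ν 𝕜} {R : Matrix μ μ 𝕜} (hO : IsUnit O.det)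
    (hR : IsUnit R.det) : IsUnit (kkt (O * H * Oᵀ) (R * Q * Oᵀ)).det ↔ IsUnit (kkt H Q).det := by
  rw [det_kkt_conj, IsUnit.mul_iff]
  exact ⟨fun h => h.2, fun h => ⟨(hO.mul hR).pow 2, h⟩⟩

/-- [folklore] **INVARIANCE OF THE ONE SHOT UP TO AN ADDITIVE CONSTANT** (real field, merely INVERTIBLE rotations):
`log|det kkt(OHOᵀ, RQOᵀ)| = log|det kkt(H,Q)| + 2·log|det O · det R|` when the three determinants are non-zero. -/
theorem log_abs_det_kkt_conj (H : Matrix ν ν ℝ) (Q : Matrix μ ν ℝ) {O : Matrix ν ν ℝ} {R : Matrix μ μ ℝ} (hO : O.det ≠ 0) (hR : R.det ≠ 0)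
    (hK : (kkt H Q).det ≠ 0) :
    Real.log |(kkt (O * H * Oᵀ) (R * Q * Oᵀ)).det| = Real.log |(kkt H Q).det| + 2 * Real.log |O.det * R.det| := by
  rw [det_kkt_conj, abs_mul, abs_pow, Real.log_mul (pow_ne_zero 2 (abs_ne_zero.mpr (mul_ne_zero hO hR))) (abs_ne_zero.mpr hK),
    Real.log_pow]
  push_cast
  ring

/-- [folklore] The same in the road's one-shot currency `−½log|det kkt|`: `W(OHOᵀ, RQOᵀ) = W(H,Q) + c` with the EXPLICIT constant
`c = −log|det O · det R|` (`= 0` for orthogonal rotations) — the shape `Φ(ρ v) = Φ v + c` of the hypothesis `hinv` of row GAMMA-0c (ii)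
(`FP/TadpoleAdInvariance.tadpole_eq_of_invariant`). -/
theorem oneShot_conj (H : Matrix ν ν ℝ) (Q : Matrix μ ν ℝ) {O : Matrix ν ν ℝ} {R : Matrix μ μ ℝ} (hO : O.det ≠ 0) (hR : R.det ≠ 0)
    (hK : (kkt H Q).det ≠ 0) :
    -(1 / 2 : ℝ) * Real.log |(kkt (O * H * Oᵀ) (R * Q * Oᵀ)).det|
      = -(1 / 2 : ℝ) * Real.log |(kkt H Q).det| + -Real.log |O.det * R.det| := by
  rw [log_abs_det_kkt_conj H Q hO hR hK]
  ring

/-- [folklore] For orthogonal rotations the one shot is INVARIANT on the nose (no constant, no non-degeneracy needed). -/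
theorem oneShot_conj_of_orthogonal (H : Matrix ν ν ℝ) (Q : Matrix μ ν ℝ) {O : Matrix ν ν ℝ} {R : Matrix μ μ ℝ} (hO : O * Oᵀ = 1)
    (hR : R * Rᵀ = 1) :
    -(1 / 2 : ℝ) * Real.log |(kkt (O * H * Oᵀ) (R * Q * Oᵀ)).det| = -(1 / 2 : ℝ) * Real.log |(kkt H Q).det| := by
  rw [det_kkt_conj_of_orthogonal H Q hO hR]

omit [Fintype μ] [DecidableEq μ] in
/-- [folklore] `O Oᵀ = 1 ⟹ Oᵀ O = 1` (square matrices over a field). -/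
theorem transpose_mul_self_of_mul_transpose {O : Matrix ν ν 𝕜} (hO : O * Oᵀ = 1) : Oᵀ * O = 1 := by
  rw [← Matrix.inv_eq_right_inv hO]
  exact Matrix.nonsing_inv_mul O (Matrix.isUnit_det_of_right_inverse hO)

/-- [folklore] The block-diagonal of two orthogonal matrices is orthogonal (both orders). -/
theorem fromBlocks_diag_orthogonal {O : Matrix ν ν 𝕜} {R : Matrix μ μ 𝕜} (hO : O * Oᵀ = 1) (hR : R * Rᵀ = 1) :
    fromBlocks O 0 0 R * (fromBlocks O 0 0 R)ᵀ = 1 ∧ (fromBlocks O 0 0 R)ᵀ * fromBlocks O 0 0 R = 1 := by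
  constructor
  · rw [fromBlocks_transpose, fromBlocks_multiply, hO, hR, ← fromBlocks_one]
    simp only [transpose_zero, Matrix.mul_zero, Matrix.zero_mul, add_zero, zero_add]
  · rw [fromBlocks_transpose, fromBlocks_multiply, transpose_mul_self_of_mul_transpose hO, transpose_mul_self_of_mul_transpose hR,
      ← fromBlocks_one]
    simp only [transpose_zero, Matrix.mul_zero, Matrix.zero_mul, add_zero, zero_add]

/-- [folklore] THE BORDERED INVERSE IS CONJUGATED TOO (orthogonal rotations; no non-degeneracy needed — both sides vanish together):
`(kkt (OHOᵀ) (RQOᵀ))⁻¹ = [[O,0],[0,R]] · (kkt H Q)⁻¹ · [[O,0],[0,R]]ᵀ`. -/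
theorem kktInv_conj_of_orthogonal (H : Matrix ν ν 𝕜) (Q : Matrix μ ν 𝕜) {O : Matrix ν ν 𝕜} {R : Matrix μ μ 𝕜} (hO : O * Oᵀ = 1)
    (hR : R * Rᵀ = 1) :
    (kkt (O * H * Oᵀ) (R * Q * Oᵀ))⁻¹ = fromBlocks O 0 0 R * (kkt H Q)⁻¹ * (fromBlocks O 0 0 R)ᵀ := by
  obtain ⟨hD, hD'⟩ := fromBlocks_diag_orthogonal hO hR
  have hDinv : (fromBlocks O 0 0 R : Matrix (ν ⊕ μ) (ν ⊕ μ) 𝕜)⁻¹ = (fromBlocks O 0 0 R)ᵀ := Matrix.inv_eq_right_inv hD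
  have hDTinv : ((fromBlocks O 0 0 R : Matrix (ν ⊕ μ) (ν ⊕ μ) 𝕜)ᵀ)⁻¹ = fromBlocks O 0 0 R := Matrix.inv_eq_right_inv hD'
  rw [kkt_conj, Matrix.mul_inv_rev, Matrix.mul_inv_rev, hDinv, hDTinv, Matrix.mul_assoc]

/-- [folklore] **COVARIANCE OF THE LEGS** (orthogonal rotations): the fluctuation covariance, the minimiser and its left companion, and the
effective form of the rotated datum are the rotated ones — `Γ(OHOᵀ,RQOᵀ) = OΓOᵀ`, `𝓘 ↦ O𝓘Rᵀ`, `𝓘ᴸ ↦ R𝓘ᴸOᵀ`, `S ↦ RSRᵀ`. -/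
theorem blocks_conj_of_orthogonal (H : Matrix ν ν 𝕜) (Q : Matrix μ ν 𝕜) {O : Matrix ν ν 𝕜} {R : Matrix μ μ 𝕜} (hO : O * Oᵀ = 1)
    (hR : R * Rᵀ = 1) :
    flucCov (O * H * Oᵀ) (R * Q * Oᵀ) = O * flucCov H Q * Oᵀ ∧ minOp (O * H * Oᵀ) (R * Q * Oᵀ) = O * minOp H Q * Rᵀ ∧
      minOpL (O * H * Oᵀ) (R * Q * Oᵀ) = R * minOpL H Q * Oᵀ ∧ effForm (O * H * Oᵀ) (R * Q * Oᵀ) = R * effForm H Q * Rᵀ := by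
  have h := kktInv_conj_of_orthogonal H Q hO hR
  rw [kktInv_eq_fromBlocks, kktInv_eq_fromBlocks, fromBlocks_transpose, fromBlocks_multiply, fromBlocks_multiply] at h
  simp only [transpose_zero, Matrix.mul_zero, Matrix.zero_mul, add_zero, zero_add, fromBlocks_inj] at h
  obtain ⟨h11, h12, h21, h22⟩ := h
  refine ⟨h11, h12, h21, ?_⟩
  rw [Matrix.mul_neg, Matrix.neg_mul, neg_inj] at h22
  exact h22

end Conjugation

/-! ## §2 The second-order chain rule through a gauge map along a line -/

section ChainRule

variable {E E' G : Type*} [NormedAddCommGroup E] [NormedSpace ℝ E] [NormedAddCommGroup E'] [NormedSpace ℝ E']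
  [NormedAddCommGroup G] [NormedSpace ℝ G]

/-- [folklore] THE CURVE THROUGH THE GAUGE MAP: if `ax` has Fréchet derivative `dax x` at every `x` near `x₀`, then `s ↦ ax (x₀ + s•v)` has
derivative `dax (x₀ + s•v) v` at every `s` near `0`. -/
theorem hasDerivAt_ax_line {ax : E' → E} {dax : E' → (E' →L[ℝ] E)} {x₀ : E'} (hax : ∀ᶠ x in 𝓝 x₀, HasFDerivAt ax (dax x) x) (v : E') :
    ∀ᶠ s in 𝓝 (0 : ℝ), HasDerivAt (fun s : ℝ => ax (x₀ + s • v)) (dax (x₀ + s • v) v) s := by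
  have hline : ∀ s : ℝ, HasDerivAt (fun s : ℝ => x₀ + s • v) v s := fun s => by
    have h := ((hasDerivAt_id s).smul_const v).const_add x₀
    rwa [one_smul] at h
  have hcont : Tendsto (fun s : ℝ => x₀ + s • v) (𝓝 0) (𝓝 x₀) := by
    have h := (hline 0).continuousAt.tendsto
    rwa [zero_smul, add_zero] at h
  filter_upwards [hcont.eventually hax] with s hs
  exact hs.comp_hasDerivAt s (hline s)

/-- [folklore] THE SECOND JET OF THE GAUGE MAP ALONG THE LINE: if `dax` has Fréchet derivative `d2ax` at `x₀`, the first-jet curve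
`s ↦ dax (x₀ + s•v) v` has derivative `d2ax v v` at `0`. -/
theorem hasDerivAt_dax_line {dax : E' → (E' →L[ℝ] E)} {d2ax : E' →L[ℝ] E' →L[ℝ] E} {x₀ : E'} (hdax : HasFDerivAt dax d2ax x₀) (v : E') :
    HasDerivAt (fun s : ℝ => dax (x₀ + s • v) v) (d2ax v v) 0 := by
  have h := (hasDerivAt_comp_line hdax v).clm_apply (hasDerivAt_const (0 : ℝ) v)
  refine h.congr_deriv ?_
  rw [map_zero, add_zero]

/-- [folklore] **THE SECOND-ORDER CHAIN RULE `D²(F∘ax)(x₀)[v,v] = D²F(ax x₀)[Dax v, Dax v] + DF(ax x₀)[D²ax(v,v)]`**, along the line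
`s ↦ x₀ + s•v`: (i) near `0` the composite `s ↦ F (ax (x₀ + s•v))` has derivative `dF(ax(x₀+s•v))[dax(x₀+s•v) v]`; (ii) this first-jet curve has
derivative `d2F (dax x₀ v) (dax x₀ v) + dF (ax x₀) (d2ax v v)` at `0` — the PULL-BACK of `D²F` by `Dax` plus the `D²ax`-TADPOLE. -/
theorem hasDerivAt_comp_ax_line {F : E → G} {dF : E → (E →L[ℝ] G)} {d2F : E →L[ℝ] E →L[ℝ] G} {ax : E' → E} {dax : E' → (E' →L[ℝ] E)}
    {d2ax : E' →L[ℝ] E' →L[ℝ] E} {x₀ : E'} (hax : ∀ᶠ x in 𝓝 x₀, HasFDerivAt ax (dax x) x) (hdax : HasFDerivAt dax d2ax x₀)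
    (hF : ∀ᶠ y in 𝓝 (ax x₀), HasFDerivAt F (dF y) y) (hdF : HasFDerivAt dF d2F (ax x₀)) (v : E') :
    (∀ᶠ s in 𝓝 (0 : ℝ), HasDerivAt (fun s : ℝ => F (ax (x₀ + s • v))) (dF (ax (x₀ + s • v)) (dax (x₀ + s • v) v)) s) ∧
      HasDerivAt (fun s : ℝ => dF (ax (x₀ + s • v)) (dax (x₀ + s • v) v)) (d2F (dax x₀ v) (dax x₀ v) + dF (ax x₀) (d2ax v v)) 0 := by
  have e0 : x₀ + (0 : ℝ) • v = x₀ := by rw [zero_smul, add_zero]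
  have hγ : ∀ᶠ s in 𝓝 (0 : ℝ), HasDerivAt (fun s : ℝ => ax (x₀ + s • v)) ((fun s : ℝ => dax (x₀ + s • v) v) s) s :=
    hasDerivAt_ax_line hax v
  have hF' : ∀ᶠ y in 𝓝 ((fun s : ℝ => ax (x₀ + s • v)) 0), HasFDerivAt F (dF y) y := by
    show ∀ᶠ y in 𝓝 (ax (x₀ + (0 : ℝ) • v)), HasFDerivAt F (dF y) y
    rw [e0]; exact hF
  have hdF' : HasFDerivAt dF d2F ((fun s : ℝ => ax (x₀ + s • v)) 0) := by
    show HasFDerivAt dF d2F (ax (x₀ + (0 : ℝ) • v))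
    rw [e0]; exact hdF
  refine ⟨hasDerivAt_comp_curve hγ hF', ?_⟩
  have h2 := hasDerivAt_jet₁_comp_curve hγ.self_of_nhds (hasDerivAt_dax_line hdax v) hdF'
  refine h2.congr_deriv ?_
  simp only [zero_smul, add_zero]

/-- [folklore] **THE PURE PULL-BACK** when the `D²ax`-tadpole vanishes: `DF(ax x₀)[D²ax(v,v)] = 0 ⟹ D²(F∘ax)(x₀)[v,v] = D²F[Dax v, Dax v]`. -/
theorem hasDerivAt_comp_ax_line_of_tadpole_eq_zero {F : E → G} {dF : E → (E →L[ℝ] G)} {d2F : E →L[ℝ] E →L[ℝ] G} {ax : E' → E}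
    {dax : E' → (E' →L[ℝ] E)} {d2ax : E' →L[ℝ] E' →L[ℝ] E} {x₀ : E'} (hax : ∀ᶠ x in 𝓝 x₀, HasFDerivAt ax (dax x) x)
    (hdax : HasFDerivAt dax d2ax x₀) (hF : ∀ᶠ y in 𝓝 (ax x₀), HasFDerivAt F (dF y) y) (hdF : HasFDerivAt dF d2F (ax x₀)) (v : E')
    (htad : dF (ax x₀) (d2ax v v) = 0) :
    HasDerivAt (fun s : ℝ => dF (ax (x₀ + s • v)) (dax (x₀ + s • v) v)) (d2F (dax x₀ v) (dax x₀ v)) 0 := by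
  refine (hasDerivAt_comp_ax_line hax hdax hF hdF v).2.congr_deriv ?_
  rw [htad, add_zero]

/-- [folklore] The pure pull-back from a vanishing FIRST VARIATION `DF(ax x₀) = 0` — the conclusion of row GAMMA-0c (Ad-invariance + no invariant
covector) at the symmetric background. -/
theorem hasDerivAt_comp_ax_line_of_fderiv_eq_zero {F : E → G} {dF : E → (E →L[ℝ] G)} {d2F : E →L[ℝ] E →L[ℝ] G} {ax : E' → E}
    {dax : E' → (E' →L[ℝ] E)} {d2ax : E' →L[ℝ] E' →L[ℝ] E} {x₀ : E'} (hax : ∀ᶠ x in 𝓝 x₀, HasFDerivAt ax (dax x) x)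
    (hdax : HasFDerivAt dax d2ax x₀) (hF : ∀ᶠ y in 𝓝 (ax x₀), HasFDerivAt F (dF y) y) (hdF : HasFDerivAt dF d2F (ax x₀)) (v : E')
    (hcrit : dF (ax x₀) = 0) :
    HasDerivAt (fun s : ℝ => dF (ax (x₀ + s • v)) (dax (x₀ + s • v) v)) (d2F (dax x₀ v) (dax x₀ v)) 0 :=
  hasDerivAt_comp_ax_line_of_tadpole_eq_zero hax hdax hF hdF v (by rw [hcrit, _root_.zero_apply])

end ChainRule

/-! ## §2b The one-shot instance: six loops at the pulled-back jets plus the `D²ax`-tadpole -/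

section OneShot

variable {E' : Type*} [NormedAddCommGroup E'] [NormedSpace ℝ E']
variable {κ ν ρ : Type*} [Fintype κ] [Fintype ν] [Fintype ρ] [DecidableEq ν] [DecidableEq ρ]

/-- [folklore] **THE ONE SHOT THROUGH A GAUGE MAP** (`OneShotKKTTorus.hasDerivAt_oneShot_comp_curve_tadpole` on the curve `s ↦ ax (x₀ + s•v)`):
the first variation `−½tr(Γ·DHf[γ̇]) − tr(𝓘·DQf[γ̇])` of `s ↦ −½log|det kkt(Hf(ax(x₀+s•v)), Qf(ax(x₀+s•v)))|` has derivative at `0` the SIX LOOPS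
of `KKTSecondVariation` at the background `ax x₀` with the PULLED-BACK JETS `Ḣ = DHf[Dax v]`, `Q̇ = DQf[Dax v]`, `Ḧ = D²Hf[Dax v, Dax v]`,
`Q̈ = D²Qf[Dax v, Dax v]`, PLUS the `D²ax`-TADPOLE `−½tr(Γ·DHf[D²ax(v,v)]) − tr(𝓘·DQf[D²ax(v,v)])` displayed separately. -/
theorem hasDerivAt_oneShot_comp_ax_line {ax : E' → (κ → ℝ)} {dax : E' → (E' →L[ℝ] (κ → ℝ))} {d2ax : E' →L[ℝ] E' →L[ℝ] (κ → ℝ)} {x₀ : E'}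
    {Hf : (κ → ℝ) → ν → ν → ℝ} {dHf : (κ → ℝ) → ((κ → ℝ) →L[ℝ] (ν → ν → ℝ))} {d2Hf : (κ → ℝ) →L[ℝ] (κ → ℝ) →L[ℝ] (ν → ν → ℝ)}
    {Qf : (κ → ℝ) → ρ → ν → ℝ} {dQf : (κ → ℝ) → ((κ → ℝ) →L[ℝ] (ρ → ν → ℝ))} {d2Qf : (κ → ℝ) →L[ℝ] (κ → ℝ) →L[ℝ] (ρ → ν → ℝ)}
    (hax : ∀ᶠ x in 𝓝 x₀, HasFDerivAt ax (dax x) x) (hdax : HasFDerivAt dax d2ax x₀)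
    (hH : ∀ᶠ x in 𝓝 (ax x₀), HasFDerivAt Hf (dHf x) x) (hdH : HasFDerivAt dHf d2Hf (ax x₀))
    (hQ : ∀ᶠ x in 𝓝 (ax x₀), HasFDerivAt Qf (dQf x) x) (hdQ : HasFDerivAt dQf d2Qf (ax x₀))
    (hsym : ∀ᶠ x in 𝓝 (ax x₀), (Matrix.of (Hf x))ᵀ = Matrix.of (Hf x))
    (hdet : (kkt (Matrix.of (Hf (ax x₀))) (Matrix.of (Qf (ax x₀)))).det ≠ 0) (v : E') :
    HasDerivAt (fun u : ℝ => -(1 / 2 : ℝ) * (flucCov (Matrix.of (Hf (ax (x₀ + u • v)))) (Matrix.of (Qf (ax (x₀ + u • v))))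
            * Matrix.of (dHf (ax (x₀ + u • v)) (dax (x₀ + u • v) v))).trace
          - (minOp (Matrix.of (Hf (ax (x₀ + u • v)))) (Matrix.of (Qf (ax (x₀ + u • v)))) * Matrix.of (dQf (ax (x₀ + u • v)) (dax (x₀ + u • v) v))).trace)
      ((1 / 2 : ℝ) * (flucCov (Matrix.of (Hf (ax x₀))) (Matrix.of (Qf (ax x₀))) * Matrix.of (dHf (ax x₀) (dax x₀ v))
            * (flucCov (Matrix.of (Hf (ax x₀))) (Matrix.of (Qf (ax x₀))) * Matrix.of (dHf (ax x₀) (dax x₀ v)))).trace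
        - (1 / 2 : ℝ) * (flucCov (Matrix.of (Hf (ax x₀))) (Matrix.of (Qf (ax x₀))) * Matrix.of (d2Hf (dax x₀ v) (dax x₀ v))).trace
        + 2 * (flucCov (Matrix.of (Hf (ax x₀))) (Matrix.of (Qf (ax x₀))) * Matrix.of (dHf (ax x₀) (dax x₀ v))
            * (minOp (Matrix.of (Hf (ax x₀))) (Matrix.of (Qf (ax x₀))) * Matrix.of (dQf (ax x₀) (dax x₀ v)))).trace
        + (minOp (Matrix.of (Hf (ax x₀))) (Matrix.of (Qf (ax x₀))) * Matrix.of (dQf (ax x₀) (dax x₀ v))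
            * (minOp (Matrix.of (Hf (ax x₀))) (Matrix.of (Qf (ax x₀))) * Matrix.of (dQf (ax x₀) (dax x₀ v)))).trace
        - (effForm (Matrix.of (Hf (ax x₀))) (Matrix.of (Qf (ax x₀))) * (Matrix.of (dQf (ax x₀) (dax x₀ v))
            * (flucCov (Matrix.of (Hf (ax x₀))) (Matrix.of (Qf (ax x₀))) * (Matrix.of (dQf (ax x₀) (dax x₀ v)))ᵀ))).trace
        - (minOp (Matrix.of (Hf (ax x₀))) (Matrix.of (Qf (ax x₀))) * Matrix.of (d2Qf (dax x₀ v) (dax x₀ v))).trace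
        + (-(1 / 2 : ℝ) * (flucCov (Matrix.of (Hf (ax x₀))) (Matrix.of (Qf (ax x₀))) * Matrix.of (dHf (ax x₀) (d2ax v v))).trace
            - (minOp (Matrix.of (Hf (ax x₀))) (Matrix.of (Qf (ax x₀))) * Matrix.of (dQf (ax x₀) (d2ax v v))).trace)) 0 := by
  have e0 : x₀ + (0 : ℝ) • v = x₀ := by rw [zero_smul, add_zero]
  have hγ : ∀ᶠ s in 𝓝 (0 : ℝ), HasDerivAt (fun s : ℝ => ax (x₀ + s • v)) ((fun s : ℝ => dax (x₀ + s • v) v) s) s :=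
    hasDerivAt_ax_line hax v
  have hH' : ∀ᶠ x in 𝓝 (ax (x₀ + (0 : ℝ) • v)), HasFDerivAt Hf (dHf x) x := by rw [e0]; exact hH
  have hdH' : HasFDerivAt dHf d2Hf (ax (x₀ + (0 : ℝ) • v)) := by rw [e0]; exact hdH
  have hQ' : ∀ᶠ x in 𝓝 (ax (x₀ + (0 : ℝ) • v)), HasFDerivAt Qf (dQf x) x := by rw [e0]; exact hQ
  have hdQ' : HasFDerivAt dQf d2Qf (ax (x₀ + (0 : ℝ) • v)) := by rw [e0]; exact hdQ
  have hsym' : ∀ᶠ x in 𝓝 (ax (x₀ + (0 : ℝ) • v)), (Matrix.of (Hf x))ᵀ = Matrix.of (Hf x) := by rw [e0]; exact hsym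
  have hdet' : (kkt (Matrix.of (Hf (ax (x₀ + (0 : ℝ) • v)))) (Matrix.of (Qf (ax (x₀ + (0 : ℝ) • v))))).det ≠ 0 := by
    rw [e0]; exact hdet
  have h := hasDerivAt_oneShot_comp_curve_tadpole (γ := fun s : ℝ => ax (x₀ + s • v)) (γ₁ := fun s : ℝ => dax (x₀ + s • v) v)
    (t := 0) hγ (hasDerivAt_dax_line hdax v) hH' hdH' hQ' hdQ' hsym' hdet'
  simp only [zero_smul, add_zero] at h
  exact h

/-- [folklore] **THE PURE PULL-BACK OF THE ONE SHOT** under the displayed hypothesis that the `D²ax`-tadpole vanishes (on the road: the first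
variation of the straight one shot at the symmetric background is zero by GAMMA-0c, so `DF^{str}(𝟙)[(ax)″(Ḃ,Ḃ)] = 0`): `D²(F∘ax)(x₀)[v,v]` is
EXACTLY the six loops at the pulled-back jets — memo §3's «`D²F^{root}(𝟙)[Ḃ,Ḃ] = D²F^{str}(𝟙)[P^{ax}Ḃ, P^{ax}Ḃ]`» at matrix level. -/
theorem hasDerivAt_oneShot_comp_ax_line_of_tadpole_eq_zero {ax : E' → (κ → ℝ)} {dax : E' → (E' →L[ℝ] (κ → ℝ))}
    {d2ax : E' →L[ℝ] E' →L[ℝ] (κ → ℝ)} {x₀ : E'}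
    {Hf : (κ → ℝ) → ν → ν → ℝ} {dHf : (κ → ℝ) → ((κ → ℝ) →L[ℝ] (ν → ν → ℝ))} {d2Hf : (κ → ℝ) →L[ℝ] (κ → ℝ) →L[ℝ] (ν → ν → ℝ)}
    {Qf : (κ → ℝ) → ρ → ν → ℝ} {dQf : (κ → ℝ) → ((κ → ℝ) →L[ℝ] (ρ → ν → ℝ))} {d2Qf : (κ → ℝ) →L[ℝ] (κ → ℝ) →L[ℝ] (ρ → ν → ℝ)}
    (hax : ∀ᶠ x in 𝓝 x₀, HasFDerivAt ax (dax x) x) (hdax : HasFDerivAt dax d2ax x₀)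
    (hH : ∀ᶠ x in 𝓝 (ax x₀), HasFDerivAt Hf (dHf x) x) (hdH : HasFDerivAt dHf d2Hf (ax x₀))
    (hQ : ∀ᶠ x in 𝓝 (ax x₀), HasFDerivAt Qf (dQf x) x) (hdQ : HasFDerivAt dQf d2Qf (ax x₀))
    (hsym : ∀ᶠ x in 𝓝 (ax x₀), (Matrix.of (Hf x))ᵀ = Matrix.of (Hf x))
    (hdet : (kkt (Matrix.of (Hf (ax x₀))) (Matrix.of (Qf (ax x₀)))).det ≠ 0) (v : E')
    (htad : -(1 / 2 : ℝ) * (flucCov (Matrix.of (Hf (ax x₀))) (Matrix.of (Qf (ax x₀))) * Matrix.of (dHf (ax x₀) (d2ax v v))).trace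
            - (minOp (Matrix.of (Hf (ax x₀))) (Matrix.of (Qf (ax x₀))) * Matrix.of (dQf (ax x₀) (d2ax v v))).trace = 0) :
    HasDerivAt (fun u : ℝ => -(1 / 2 : ℝ) * (flucCov (Matrix.of (Hf (ax (x₀ + u • v)))) (Matrix.of (Qf (ax (x₀ + u • v))))
            * Matrix.of (dHf (ax (x₀ + u • v)) (dax (x₀ + u • v) v))).trace
          - (minOp (Matrix.of (Hf (ax (x₀ + u • v)))) (Matrix.of (Qf (ax (x₀ + u • v)))) * Matrix.of (dQf (ax (x₀ + u • v)) (dax (x₀ + u • v) v))).trace)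
      ((1 / 2 : ℝ) * (flucCov (Matrix.of (Hf (ax x₀))) (Matrix.of (Qf (ax x₀))) * Matrix.of (dHf (ax x₀) (dax x₀ v))
            * (flucCov (Matrix.of (Hf (ax x₀))) (Matrix.of (Qf (ax x₀))) * Matrix.of (dHf (ax x₀) (dax x₀ v)))).trace
        - (1 / 2 : ℝ) * (flucCov (Matrix.of (Hf (ax x₀))) (Matrix.of (Qf (ax x₀))) * Matrix.of (d2Hf (dax x₀ v) (dax x₀ v))).trace
        + 2 * (flucCov (Matrix.of (Hf (ax x₀))) (Matrix.of (Qf (ax x₀))) * Matrix.of (dHf (ax x₀) (dax x₀ v))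
            * (minOp (Matrix.of (Hf (ax x₀))) (Matrix.of (Qf (ax x₀))) * Matrix.of (dQf (ax x₀) (dax x₀ v)))).trace
        + (minOp (Matrix.of (Hf (ax x₀))) (Matrix.of (Qf (ax x₀))) * Matrix.of (dQf (ax x₀) (dax x₀ v))
            * (minOp (Matrix.of (Hf (ax x₀))) (Matrix.of (Qf (ax x₀))) * Matrix.of (dQf (ax x₀) (dax x₀ v)))).trace
        - (effForm (Matrix.of (Hf (ax x₀))) (Matrix.of (Qf (ax x₀))) * (Matrix.of (dQf (ax x₀) (dax x₀ v))
            * (flucCov (Matrix.of (Hf (ax x₀))) (Matrix.of (Qf (ax x₀))) * (Matrix.of (dQf (ax x₀) (dax x₀ v)))ᵀ))).trace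
        - (minOp (Matrix.of (Hf (ax x₀))) (Matrix.of (Qf (ax x₀))) * Matrix.of (d2Qf (dax x₀ v) (dax x₀ v))).trace) 0 := by
  refine (hasDerivAt_oneShot_comp_ax_line hax hdax hH hdH hQ hdQ hsym hdet v).congr_deriv ?_
  rw [htad, add_zero]

end OneShot

/-! ## §3 The gauge form `F^{root}(B) = F^{str}(B^{ax})` -/

section GaugeForm

variable {β 𝒢 : Type*} {ν ρ : Type*} [Fintype ν] [Fintype ρ] [DecidableEq ν] [DecidableEq ρ]

/-- [folklore] **COVARIANCE ⟹ INVARIANCE OF THE BORDERED DETERMINANT**: if at the two backgrounds `B`, `B′` the fine form and the constraint map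
are conjugate by an orthogonal pair, `Hf B′ = O·Hf B·Oᵀ`, `Qf B′ = R·Qf B·Oᵀ`, then `det kkt(Hf B′, Qf B′) = det kkt(Hf B, Qf B)` (memo §3:
`H_cov(B^h) = Ad_h H_cov(B) Ad_h⁻¹`, `Q_{B^h} = Q_B ∘ Ad_h⁻¹`). -/
theorem det_kkt_eq_of_covariant {Hf : β → Matrix ν ν ℝ} {Qf : β → Matrix ρ ν ℝ} {B B' : β} {O : Matrix ν ν ℝ} {R : Matrix ρ ρ ℝ}
    (hO : O * Oᵀ = 1) (hR : R * Rᵀ = 1) (hH : Hf B' = O * Hf B * Oᵀ) (hQ : Qf B' = R * Qf B * Oᵀ) :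
    (kkt (Hf B') (Qf B')).det = (kkt (Hf B) (Qf B)).det := by
  rw [hH, hQ, det_kkt_conj_of_orthogonal (Hf B) (Qf B) hO hR]

/-- [folklore] The same for the one shot `−½log|det kkt|`. -/
theorem oneShot_eq_of_covariant {Hf : β → Matrix ν ν ℝ} {Qf : β → Matrix ρ ν ℝ} {B B' : β} {O : Matrix ν ν ℝ} {R : Matrix ρ ρ ℝ}
    (hO : O * Oᵀ = 1) (hR : R * Rᵀ = 1) (hH : Hf B' = O * Hf B * Oᵀ) (hQ : Qf B' = R * Qf B * Oᵀ) :
    -(1 / 2 : ℝ) * Real.log |(kkt (Hf B') (Qf B')).det| = -(1 / 2 : ℝ) * Real.log |(kkt (Hf B) (Qf B)).det| := by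
  rw [det_kkt_eq_of_covariant hO hR hH hQ]

/-- [folklore] **THE GAUGE FORM `F^{root}(B) = F^{str}(B^{ax})`** (memo §3 at matrix level).  Letters: backgrounds `B : β`; gauge letters `h : 𝒢`
acting by `act h`; colour rotation `O h` of the fine variables and `R h` of the block variables (`R h = 1` for a root-fixing `h` on the road), both
orthogonal for `RootFixing h`; ONE fine form `Hf` («`H_cov`») and TWO constraint maps `Qroot`, `Qstr` (rooted ∕ straight block averages), with
(cov) `Hf`, `Qroot` covariant under root-fixing `h`, (ax) an axialisation `hB : β → 𝒢` by root-fixing letters landing in `Axial` backgrounds,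
(agree) `Qroot = Qstr` on `Axial` backgrounds («for tree-axial backgrounds all radial transports are identities»).  Then the ROOTED one shot at
`B` IS the STRAIGHT one shot at `B^{ax} := act (hB B) B`. -/
theorem oneShot_root_eq_str_ax {act : 𝒢 → β → β} {RootFixing : 𝒢 → Prop} {Axial : β → Prop} {O : 𝒢 → Matrix ν ν ℝ}
    {R : 𝒢 → Matrix ρ ρ ℝ} {Hf : β → Matrix ν ν ℝ} {Qroot Qstr : β → Matrix ρ ν ℝ} {hB : β → 𝒢}
    (hO : ∀ h, RootFixing h → O h * (O h)ᵀ = 1) (hR : ∀ h, RootFixing h → R h * (R h)ᵀ = 1)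
    (hHcov : ∀ h B, RootFixing h → Hf (act h B) = O h * Hf B * (O h)ᵀ)
    (hQcov : ∀ h B, RootFixing h → Qroot (act h B) = R h * Qroot B * (O h)ᵀ)
    (hfix : ∀ B, RootFixing (hB B)) (hax : ∀ B, Axial (act (hB B) B)) (hagree : ∀ B', Axial B' → Qroot B' = Qstr B') (B : β) :
    -(1 / 2 : ℝ) * Real.log |(kkt (Hf B) (Qroot B)).det|
      = -(1 / 2 : ℝ) * Real.log |(kkt (Hf (act (hB B) B)) (Qstr (act (hB B) B))).det| := by
  rw [← hagree _ (hax B)]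
  exact (oneShot_eq_of_covariant (Hf := Hf) (Qf := Qroot) (hO _ (hfix B)) (hR _ (hfix B)) (hHcov _ B (hfix B)) (hQcov _ B (hfix B))).symm

/-- [folklore] The bordered determinants themselves agree: `det kkt(Hf B, Qroot B) = det kkt(Hf B^{ax}, Qstr B^{ax})` — so non-degeneracy of the
rooted datum at `B` is that of the straight datum at `B^{ax}`. -/
theorem det_kkt_root_eq_str_ax {act : 𝒢 → β → β} {RootFixing : 𝒢 → Prop} {Axial : β → Prop} {O : 𝒢 → Matrix ν ν ℝ}
    {R : 𝒢 → Matrix ρ ρ ℝ} {Hf : β → Matrix ν ν ℝ} {Qroot Qstr : β → Matrix ρ ν ℝ} {hB : β → 𝒢}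
    (hO : ∀ h, RootFixing h → O h * (O h)ᵀ = 1) (hR : ∀ h, RootFixing h → R h * (R h)ᵀ = 1)
    (hHcov : ∀ h B, RootFixing h → Hf (act h B) = O h * Hf B * (O h)ᵀ)
    (hQcov : ∀ h B, RootFixing h → Qroot (act h B) = R h * Qroot B * (O h)ᵀ)
    (hfix : ∀ B, RootFixing (hB B)) (hax : ∀ B, Axial (act (hB B) B)) (hagree : ∀ B', Axial B' → Qroot B' = Qstr B') (B : β) :
    (kkt (Hf B) (Qroot B)).det = (kkt (Hf (act (hB B) B)) (Qstr (act (hB B) B))).det := by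
  rw [← hagree _ (hax B)]
  exact (det_kkt_eq_of_covariant (Hf := Hf) (Qf := Qroot) (hO _ (hfix B)) (hR _ (hfix B)) (hHcov _ B (hfix B)) (hQcov _ B (hfix B))).symm

/-- [folklore] **THE LEGS IN THE GAUGE FORM**: the fluctuation covariance, minimiser and effective form of the STRAIGHT datum at `B^{ax}` are the
rotated legs of the ROOTED datum at `B`: `Γ^{str}(B^{ax}) = O·Γ^{root}(B)·Oᵀ`, `𝓘^{str}(B^{ax}) = O·𝓘^{root}(B)·Rᵀ`, `S^{str}(B^{ax}) = R·S^{root}(B)·Rᵀ`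
(`O = O (hB B)`, `R = R (hB B)`). -/
theorem legs_root_ax {act : 𝒢 → β → β} {RootFixing : 𝒢 → Prop} {Axial : β → Prop} {O : 𝒢 → Matrix ν ν ℝ}
    {R : 𝒢 → Matrix ρ ρ ℝ} {Hf : β → Matrix ν ν ℝ} {Qroot Qstr : β → Matrix ρ ν ℝ} {hB : β → 𝒢}
    (hO : ∀ h, RootFixing h → O h * (O h)ᵀ = 1) (hR : ∀ h, RootFixing h → R h * (R h)ᵀ = 1)
    (hHcov : ∀ h B, RootFixing h → Hf (act h B) = O h * Hf B * (O h)ᵀ)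
    (hQcov : ∀ h B, RootFixing h → Qroot (act h B) = R h * Qroot B * (O h)ᵀ)
    (hfix : ∀ B, RootFixing (hB B)) (hax : ∀ B, Axial (act (hB B) B)) (hagree : ∀ B', Axial B' → Qroot B' = Qstr B') (B : β) :
    flucCov (Hf (act (hB B) B)) (Qstr (act (hB B) B)) = O (hB B) * flucCov (Hf B) (Qroot B) * (O (hB B))ᵀ ∧
      minOp (Hf (act (hB B) B)) (Qstr (act (hB B) B)) = O (hB B) * minOp (Hf B) (Qroot B) * (R (hB B))ᵀ ∧
      effForm (Hf (act (hB B) B)) (Qstr (act (hB B) B)) = R (hB B) * effForm (Hf B) (Qroot B) * (R (hB B))ᵀ := by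
  rw [← hagree _ (hax B), hHcov _ B (hfix B), hQcov _ B (hfix B)]
  obtain ⟨h1, h2, -, h4⟩ := blocks_conj_of_orthogonal (Hf B) (Qroot B) (hO _ (hfix B)) (hR _ (hfix B))
  exact ⟨h1, h2, h4⟩

end GaugeForm

end Summit.QuantumFields.BalabanUV.Beta.FP.RootFixingGaugeForm

end
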